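import Summits.MatrixMultiplication.OmegaCensus.STPPVosperSlackOneCoverKillsZ61
import Summits.MatrixMultiplication.OmegaCensus.STPPVosperSlackOneA2CoverRowsZ61K224

/-!
# ω-census (abelian STPP census): `{(2,2,4),(3,4,2),(4,3,2)} ⊄ ℤ₆₁` — the MISSED second orientation class of the `(2,2,4)+(3,4,2)²` leaves (kernel, unconditional)

HONEST FRAMING (pub-omega census; verbatim): lottery ticket; floor = certified bounds/negative ranges.
Census STRUCTURE (seat pub-omega-stpp-2 gen 29, 2026-08-29), family (b2).  Nothing here is progress on `ω` — the theorem EXCLUDES one size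
pattern of simultaneous-triple-product families of `ℤ/61`.

BOOKKEEPING CORRECTION.  The all-seven-law lister front of `ℤ₆₁` (54 minimal beating leaves) contains the two DISTINCT `S₃`-classes
`{(2,2,4),(3,4,2),(3,4,2)}` and `{(2,2,4),(3,4,2),(4,3,2)}`.  The tree's two kills `no_isSTPP_zmod61_224_342_342_kernel` (`A,B,C`-cards
`(2,3,3),(2,4,4),(4,2,2)`) and `no_isSTPP_zmod61_224_432_432_kernel` (cards `(2,4,4),(2,3,3),(4,2,2)`) are ONE class — they differ by the role swap
`(A,B,C) ↦ (B,A,C)`, a symmetry of realisability (`exists_isSTPP_reverse` + `exists_isSTPP_rotate`) — so the leaf `{(2,2,4),(3,4,2),(4,3,2)}`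
(cards `(2,3,4),(2,4,3),(4,2,2)`, invariant under that swap) had no kernel kill: the «ℤ₆₁ 54/54 HR-kernel» count was 53/54 by classes.
This file supplies the missing kill, by the `a = 2` slack-1 law in specification form (`no_isSTPP_of_slack_one_tables_prime_a2_coverSpec`,
`STPPVosperSlackOneLawA2CoverSpec.lean`; Hamidoune–Rødseth discharged inside by `hamidouneRodsethInverseTheorem_holds`) in the reading `(C,A,B)`
(`stpp_rotate` twice), block `2` of sizes `(2,4,3)`: `(z, b, vol, a, L) = (16, 4, 24, 2, 16)`, `16+4+24+2+16 = 62 = 61+1` (slack 1), `(n, m) = (41, 17)`,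
target `J = {0, ±1, ±2, ±3}` (`target_61_a2_b4`); case γ by the tight-type table `(41,17,4)`, case β by `tableBeta 61 42 17 4` (python mirror HOME
`pub-omega-stpp-1-g30/code/lean_tables.py`: both pass), case α₂ by the row table `a2CoverRow 61 42 16 4 J 16 [(4,2,2),(2,3,4)]`
(`STPPVosperSlackOneA2CoverRowsZ61K224.lean`: every window configuration with duplicate-free point list fails the prefix law, so the cover search is never
entered — the plain `tableAlpha2 61 42 16 4` is `false` only through overlapping progressions, which the specification form excludes by `Nodup`).

References: Y. O. Hamidoune, Ø. J. Rødseth, Acta Arith. 92 (2000) 251–262; A. G. Vosper, J. London Math. Soc. 31 (1956); M. B. Nathanson, GTM 165,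
Thm 2.7; H. Cohn, R. Kleinberg, B. Szegedy, C. Umans, FOCS 2005 (arXiv:math/0511460), Def. 5.1.
-/

open Finset
open scoped Pointwise

namespace Summit.MatrixMultiplication.OmegaCensus.CubeNB

open Literature.Computability.AlgebraicComplexity
open Literature.Combinatorics.Additive
open Summit.MatrixMultiplication.OmegaCensus.STPPKneser

/-! ## Tables -/

section Tables

/-- Tight-type table `(n, m, r) = (41, 17, 4)` at `61` with target `{0, ±1, ±2, ±3}`. [folklore] -/
theorem table_41_17_4_a2b4 : ∀ j < 61, ∀ t < 61, (∀ i < 17, (t + j * i) % 61 < 41) →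
    (∀ k < 17, 4 ∣ (t + j * k) % 61 - #((range 17).filter fun i => (t + j * i) % 61 < (t + j * k) % 61)) →
    j ∈ ({0, 1, 60, 2, 59, 3, 58} : Finset ℕ) := by
  decide +kernel

/-- Case-β table `(n₁, m, b) = (42, 17, 4)` at `61` with target `{0, ±1, ±2, ±3}`. [folklore] -/
theorem tableBeta_61_42_17_4_a2b4 : tableBeta 61 42 17 4 {0, 1, 60, 2, 59, 3, 58} = true := by
  decide +kernel

end Tables

/-! ## The kill -/

section Kill

/-- **`{(2,2,4),(3,4,2),(4,3,2)}` has no STPP family in `ℤ₆₁`** (kernel, UNCONDITIONAL): no simultaneous-triple-product family of `ℤ/61` has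
`(|A₀|,|B₀|,|C₀|) = (2,2,4)`, `(|A₁|,|B₁|,|C₁|) = (3,4,2)`, `(|A₂|,|B₂|,|C₂|) = (4,3,2)`.  `a = 2` slack-1 law (specification form, cover
stage vacuous) in the reading `(C,A,B)`, block `2` (`(2,4,3)`, `(z, b, vol, a, L) = (16, 4, 24, 2, 16)`, `(m, n) = (17, 41)`); UNCONDITIONAL.
[cite: CohnKleinbergSzegedyUmans2005, Def. 5.1] [cite: HamidouneRodseth2000, main theorem (§1, p. 252)] [cite: Nathanson1996, Thm 2.7] -/
theorem no_isSTPP_zmod61_224_342_432 (A B C : Fin 3 → Finset (ZMod 61)) (hS : IsSTPP A B C)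
    (hA : ∀ i, #(A i) = ![2, 3, 4] i) (hB : ∀ i, #(B i) = ![2, 4, 3] i) (hC : ∀ i, #(C i) = ![4, 2, 2] i) :
    False := by
  haveI : Fact (Nat.Prime 61) := ⟨prime_61⟩
  have hS' : IsSTPP C A B := stpp_rotate (stpp_rotate hS)
  have hAne : ∀ i, (A i).Nonempty := fun i => card_pos.1 (by rw [hA]; fin_cases i <;> simp)
  have hBne : ∀ i, (B i).Nonempty := fun i => card_pos.1 (by rw [hB]; fin_cases i <;> simp)
  have hCne : ∀ i, (C i).Nonempty := fun i => card_pos.1 (by rw [hC]; fin_cases i <;> simp)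
  have e2 : (univ : Finset (Fin 3)).erase 2 = {0, 1} := by decide
  have hz : ∑ k ∈ (univ : Finset (Fin 3)).erase 2, #(C k) * #(B k) = 16 := by
    rw [e2, Finset.sum_pair (by decide)]; simp [hB, hC]
  have hL : ∑ k ∈ (univ : Finset (Fin 3)).erase 2, #(A k) * #(B k) = 16 := by
    rw [e2, Finset.sum_pair (by decide)]; simp [hA, hB]
  have ha : #(C 2) = 2 := by rw [hC]; simp
  have hb : #(A 2) = 4 := by rw [hA]; simp
  have hvol : #(C 2) * #(A 2) * #(B 2) = 24 := by rw [hA, hB, hC]; simp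
  have hsz : (([0, 1] : List (Fin 3)).map fun k => (#(C k), #(A k), #(B k))) = [(4, 2, 2), (2, 3, 4)] := by simp [hA, hB, hC]
  exact no_isSTPP_of_slack_one_tables_prime_a2_coverSpec C A B hS' hCne hAne hBne 2 ⟨0, by decide⟩ [0, 1] (by decide)
    (fun k => by fin_cases k <;> decide) ha hb hvol hz hL rfl (by norm_num) (by norm_num) (by norm_num) (by norm_num) (m := 17) (n := 41) rfl rfl
    target_61_a2_b4 table_41_17_4_a2b4
    (fun j hj ℓ₁ h1 h2 t₁ ht₁ t₂ ht₂ hw1 hw2 hnd hpre => by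
      rw [hsz]; exact a2CoverRow_spec (a2CoverRow_61_224_342_432_all j hj) ℓ₁ h1 h2 t₁ ht₁ t₂ ht₂ hw1 hw2 hnd hpre)
    tableBeta_61_42_17_4_a2b4

/-- The same kill in the `∄`-form used by pattern-monotonicity arguments (`not_exists_isSTPP_of_embedding`). [cite: CohnKleinbergSzegedyUmans2005, Def. 5.1] -/
theorem not_exists_isSTPP_zmod61_224_342_432 :
    ¬ ∃ A B C : Fin 3 → Finset (ZMod 61), IsSTPP A B C ∧
      ∀ i, #(A i) = ![2, 3, 4] i ∧ #(B i) = ![2, 4, 3] i ∧ #(C i) = ![4, 2, 2] i := by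
  rintro ⟨A, B, C, hS, h⟩
  exact no_isSTPP_zmod61_224_342_432 A B C hS (fun i => (h i).1) (fun i => (h i).2.1) (fun i => (h i).2.2)

end Kill

end Summit.MatrixMultiplication.OmegaCensus.CubeNB
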